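import Summits.AtomisticToContinuum.Crystallization.Theorems.FrustratedLawDichotomyEnergyRemainder

/-!
# FrustratedLawDichotomy · crux `AperiodicFrustratedLawGap` (stmt-AtomisticToContinuum-27623) — T2, PART A: THE COHERENT-WINDOW BOOKKEEPING
# (NODE-9's adjoint certificate in site-indexed form with SLOTS, over NODE-10/NODE-12; decomp-a2c lens-5, generation 112)

Pure template algebra over a real inner product space `V` (instantiated at `V = ℝ³` in PART B `…FrustratedLawDichotomyCoherentFloor`, which assembles
the class-A pointwise root-energy floor `certFloor ≤ 2·rootEnergy`).  Write the actual atoms of a coherent window as `q_z = z + δ_z` over a finite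
template `a ∋ 0` (`‖δ_z‖ ≤ τ`, `δ_0 = 0`).

* §1 kernels: `V_LJ(r) = φ(r²)` with `φ = phiT`, `φ′ = phiT1`, `φ″ = phiT2`, `ψ = 2φ′ = psiT`, `ψ′ = psiT1`; the bond force field `ljBondForce v = ψ(‖v‖²)•v`
  (= the tree's force summand, `force_eq_ljBondForce`) and its symmetric differential `ljBondForceLin` (`inner_ljBondForceLin_comm`).
* §2 the two TAYLOR SLOTS, discharged by the tree: `norm_ljBondForce_taylor_le` (NODE-10 `…ForceRemainder.norm_force_remainder_le` ⟹
  `‖g(v+w) − g(v) − L_v w‖ ≤ forceRem ‖v‖ η` for `‖w‖ ≤ η < ‖v‖`) and `phiT_taylor_ge` (NODE-12 `…EnergyRemainder.bond_energy_ge` ⟹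
  `φ(|x+u|²) ≥ φ(|x|²) + ψ(|x|²)⟪x,u⟫ − τ²·secondNeg|x| − energyRem |x| τ` for `‖u‖ ≤ τ < ‖x‖`; `secondNeg` = the negative part of the quadratic form
  `φ′‖u‖² + 2φ″⟪x,u⟫²` per unit `τ²`, credits dropped).
* §3 ★ the ADJOINT BOOKKEEPING: `certCoeff` (the adjoint field `c = Lᵀy` per site), the EXCHANGE IDENTITY `sum_inner_ljBondForceLin_eq`, the
  BOND-ANTISYMMETRIC remainder booking `abs_sum_inner_antisymm_le` (`mulExt`, `forceTaylorRem_swap`)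
  (`Σ_{x∈I}⟪y_x, Σ_{x'∈a∖x} L_{x−x'}(δ_x − δ_{x'})⟫ = Σ_{z∈a}⟪c_z(y), δ_z⟫`), and ★★ `windowSum_ge`: for ARBITRARY multipliers `y` and three SLOTS `eR`
  (energy debit per bond), `fR` (force remainder per pair), `C` (bound on the actual in-window force per interior site),
  `Σ_{x∈a∖0}(φ(|x|²) − eR x) − τ·Σ_{z∈a∖0}‖ψ(|z|²)z − c_z(y)‖ − Σ_{x∈I}⟪y_x, H_x⟫ − Σ_{x∈I}‖y_x‖(C x + Σ_{x'} fR x x') ≤ Σ_{x∈a∖0} φ(|x + δ_x|²)`,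
  `H_x = Σ_{x'∈a∖x} F(x − x')` the exact signed host force (Cauchy–Schwarz per site, Euclidean — tighter than NODE-9's flattened `ℓ¹` form
  `…AdjointCertificate.abs_dotProduct_le_of_adjointCert`).  Any sharper NODE-10′/NODE-12′ constant or another far column plugs into the slots.

UNITS: everything here is in FULL units (`Σ_n V_LJ(|q_n|) = 2·rootEnergy`, the units of the first variation `T′`); PART B halves.
DEFS `phiT phiT1 phiT2 psiT psiT1 ljBondForce ljBondForceLin forceRem energyRem secondNeg dispB certCoeff mulExt`
(plain `def`s; no instance / notation); imports the tree's `…EnergyRemainder` (NODE-12, which imports `…ForceRemainder` NODE-10) only;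
0 sorry.  All `[folklore]`; nothing here closes an item.
-/

noncomputable section

namespace Summit.AtomisticToContinuum.Crystallization.Theorems.FrustratedLawDichotomyCoherentFloorAlgebra

open RealInnerProductSpace
open scoped BigOperators
open Summit.AtomisticToContinuum.Crystallization.Theorems.FrustratedLawDichotomyForceRemainder (norm_force_remainder_le
  sq_le_norm_add_sq_of_le)
open Summit.AtomisticToContinuum.Crystallization.Theorems.FrustratedLawDichotomyEnergyRemainder (bond_energy_ge inv_sq_pow_eq)

variable {V : Type*} [NormedAddCommGroup V] [InnerProductSpace ℝ V]

/-! ## §1. The scalar kernels and the bond force field -/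

/-- `φ(t) = t⁻⁶/12 − t⁻³/6`, so that `V_LJ(r) = φ(r²)` (`lennardJones_eq_phiT`). [folklore] -/
def phiT (t : ℝ) : ℝ := 1 / 12 * t⁻¹ ^ 6 - 1 / 6 * t⁻¹ ^ 3

/-- `φ′(t) = −t⁻⁷/2 + t⁻⁴/2`. [folklore] -/
def phiT1 (t : ℝ) : ℝ := -(1 / 2) * t⁻¹ ^ 7 + 1 / 2 * t⁻¹ ^ 4

/-- `φ″(t) = (7/2)t⁻⁸ − 2t⁻⁵`. [folklore] -/
def phiT2 (t : ℝ) : ℝ := 7 / 2 * t⁻¹ ^ 8 - 2 * t⁻¹ ^ 5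

/-- `ψ(t) = t⁻⁴ − t⁻⁷ = 2φ′(t)`: the force of a bond `v` is `ψ(‖v‖²) • v`. [folklore] -/
def psiT (t : ℝ) : ℝ := t⁻¹ ^ 4 - t⁻¹ ^ 7

/-- `ψ′(t) = −4t⁻⁵ + 7t⁻⁸`. [folklore] -/
def psiT1 (t : ℝ) : ℝ := -4 * t⁻¹ ^ 5 + 7 * t⁻¹ ^ 8

/-- The Lennard-Jones force field of a bond vector, `g v = ψ(‖v‖²) • v`; at `v = p − q` this is the tree's force summand
`((dist p q)⁻¹^8 − (dist p q)⁻¹^14) • (p − q)` (`force_eq_ljBondForce`). [folklore] -/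
def ljBondForce (v : V) : V := psiT (‖v‖ ^ 2) • v

/-- The differential of `ljBondForce` at `v`: `L_v w = ψ(‖v‖²) • w + (2⟪v,w⟫ ψ′(‖v‖²)) • v` — linear and symmetric in the sense
`⟪y, L_v w⟫ = ⟪L_v y, w⟫`. [folklore] -/
def ljBondForceLin (v w : V) : V := psiT (‖v‖ ^ 2) • w + (2 * ⟪v, w⟫ * psiT1 (‖v‖ ^ 2)) • v

/-- `ψ = 2φ′`. [folklore] -/
theorem psiT_eq_two_mul_phiT1 (t : ℝ) : psiT t = 2 * phiT1 t := by
  unfold psiT phiT1; ring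

/-- The tree's force summand is `ljBondForce (p − q)`. [folklore] -/
theorem force_eq_ljBondForce (p q : V) : ((dist p q)⁻¹ ^ 8 - (dist p q)⁻¹ ^ 14) • (p - q) = ljBondForce (p - q) := by
  rw [ljBondForce, psiT, dist_eq_norm, inv_sq_pow_eq, inv_sq_pow_eq]

/-- Symmetry of the differential. [folklore] -/
theorem inner_ljBondForceLin_comm (v y w : V) : ⟪y, ljBondForceLin v w⟫ = ⟪ljBondForceLin v y, w⟫ := by
  simp only [ljBondForceLin, inner_add_left, inner_add_right, real_inner_smul_left, real_inner_smul_right]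
  rw [real_inner_comm v y]
  ring

/-- Linearity of the differential in the displacement (difference form). [folklore] -/
theorem ljBondForceLin_sub (v w₁ w₂ : V) : ljBondForceLin v (w₁ - w₂) = ljBondForceLin v w₁ - ljBondForceLin v w₂ := by
  simp only [ljBondForceLin, inner_sub_right]
  module

/-- `L_v 0 = 0`. [folklore] -/
theorem ljBondForceLin_zero (v : V) : ljBondForceLin v 0 = 0 := by
  simp [ljBondForceLin]

/-- The bond force is odd in the bond vector. [folklore] -/
theorem ljBondForce_neg (v : V) : ljBondForce (-v) = -ljBondForce v := by
  unfold ljBondForce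
  rw [norm_neg, smul_neg]

/-- The differential of the bond force is even in the bond vector … [folklore] -/
theorem ljBondForceLin_neg_left (v w : V) : ljBondForceLin (-v) w = ljBondForceLin v w := by
  unfold ljBondForceLin
  have h : (2 * -⟪v, w⟫ * psiT1 (‖v‖ ^ 2)) • (-v) = (2 * ⟪v, w⟫ * psiT1 (‖v‖ ^ 2)) • v := by
    rw [smul_neg, ← neg_smul]
    congr 1
    ring
  rw [norm_neg, inner_neg_left, h]

/-- … and odd (linear) in the displacement. [folklore] -/
theorem ljBondForceLin_neg_right (v w : V) : ljBondForceLin v (-w) = -ljBondForceLin v w := by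
  unfold ljBondForceLin
  rw [inner_neg_right, smul_neg, show 2 * -⟪v, w⟫ * psiT1 (‖v‖ ^ 2) = -(2 * ⟪v, w⟫ * psiT1 (‖v‖ ^ 2)) by ring, neg_smul]
  abel

/-- ★ ANTISYMMETRY of the force Taylor remainder of a bond under swapping its ends (`F` odd, `L` even/linear): the remainder seen from
`x'` is minus the remainder seen from `x`.  This is what lets the remainder pairing be booked per BOND with `‖y_x − y_{x'}‖`
(`abs_sum_inner_antisymm_le`) instead of per (site, bond) with `‖y_x‖`. [folklore] -/
theorem forceTaylorRem_swap (x x' e e' : V) :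
    ljBondForce ((x' + e') - (x + e)) - ljBondForce (x' - x) - ljBondForceLin (x' - x) (e' - e) =
      -(ljBondForce ((x + e) - (x' + e')) - ljBondForce (x - x') - ljBondForceLin (x - x') (e - e')) := by
  rw [show (x' + e') - (x + e) = -((x + e) - (x' + e')) by abel, show x' - x = -(x - x') by abel,
    show e' - e = -(e - e') by abel, ljBondForce_neg, ljBondForce_neg, ljBondForceLin_neg_left, ljBondForceLin_neg_right]
  abel

/-! ## §2. The two Taylor slots, discharged by NODE-10 (`…ForceRemainder`) and NODE-12 (`…EnergyRemainder`) -/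

/-- The force-remainder column entry: NODE-10's bound at bond length `r` and displacement size `η`, with `ρ = (r − η)²` and `‖δ‖`
replaced by its bound `η` (monotone). [folklore] -/
def forceRem (r η : ℝ) : ℝ :=
  max (10 * ((r - η) ^ 2)⁻¹ ^ 6) (28 * ((r - η) ^ 2)⁻¹ ^ 9) * (2 * r * η + η ^ 2) ^ 2 * (r + η)
    + |psiT1 (r ^ 2)| * (η ^ 2 * r + (2 * r * η + η ^ 2) * η)

/-- The third-order energy-remainder entry: NODE-12's bound at bond length `r`, displacement size `η`, `ρ = (r − η)²`. [folklore] -/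
def energyRem (r η : ℝ) : ℝ :=
  max (14 / 3 * ((r - η) ^ 2)⁻¹ ^ 9) (5 / 3 * ((r - η) ^ 2)⁻¹ ^ 6) * (2 * r * η + η ^ 2) ^ 3
    + |phiT2 (r ^ 2)| * (2 * r * η ^ 3 + 1 / 2 * η ^ 4)

/-- The second-order energy DEBIT per unit `τ²` at bond length `r`: the negative part of `φ′(r²) − 2r²·(φ″(r²))⁻`, i.e. the worst
case of the quadratic form `φ′‖δ‖² + 2φ″⟪x,δ⟫²` over `‖δ‖ ≤ τ` (credits from `φ′ > 0`, `φ″ > 0` are dropped, debits kept). [folklore] -/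
def secondNeg (r : ℝ) : ℝ := max 0 (-(phiT1 (r ^ 2) - 2 * r ^ 2 * max 0 (-phiT2 (r ^ 2))))

/-- ★ FORCE SLOT (from NODE-10): `‖g(v + w) − g(v) − L_v w‖ ≤ forceRem ‖v‖ η` whenever `‖w‖ ≤ η < ‖v‖`. [folklore] -/
theorem norm_ljBondForce_taylor_le (v w : V) {η : ℝ} (hw : ‖w‖ ≤ η) (hv : η < ‖v‖) :
    ‖ljBondForce (v + w) - ljBondForce v - ljBondForceLin v w‖ ≤ forceRem ‖v‖ η := by
  have hη : 0 ≤ η := (norm_nonneg w).trans hw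
  have hvη : 0 < ‖v‖ - η := by linarith
  have hρ : 0 < (‖v‖ - η) ^ 2 := by positivity
  have h₀ : (‖v‖ - η) ^ 2 ≤ ‖v‖ ^ 2 := by nlinarith [norm_nonneg v]
  have h₁ : (‖v‖ - η) ^ 2 ≤ ‖v + w‖ ^ 2 := sq_le_norm_add_sq_of_le v w hv le_rfl hw
  have h := norm_force_remainder_le v w hρ h₀ h₁
  have hlhs : ljBondForce (v + w) - ljBondForce v - ljBondForceLin v w =
      ((‖v + w‖ ^ 2)⁻¹ ^ 4 - (‖v + w‖ ^ 2)⁻¹ ^ 7) • (v + w) - ((‖v‖ ^ 2)⁻¹ ^ 4 - (‖v‖ ^ 2)⁻¹ ^ 7) • v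
        - (((‖v‖ ^ 2)⁻¹ ^ 4 - (‖v‖ ^ 2)⁻¹ ^ 7) • w + (2 * ⟪v, w⟫ * (-4 * (‖v‖ ^ 2)⁻¹ ^ 5 + 7 * (‖v‖ ^ 2)⁻¹ ^ 8)) • v) := rfl
  rw [hlhs]
  refine h.trans ?_
  have hvw : ‖v + w‖ ≤ ‖v‖ + η := (norm_add_le v w).trans (by linarith)
  have hq : 2 * ‖v‖ * ‖w‖ + ‖w‖ ^ 2 ≤ 2 * ‖v‖ * η + η ^ 2 := by nlinarith [norm_nonneg v, norm_nonneg w]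
  have hq0 : 0 ≤ 2 * ‖v‖ * ‖w‖ + ‖w‖ ^ 2 := by positivity
  have hc : |-4 * (‖v‖ ^ 2)⁻¹ ^ 5 + 7 * (‖v‖ ^ 2)⁻¹ ^ 8| = |psiT1 (‖v‖ ^ 2)| := rfl
  rw [hc]
  unfold forceRem
  have hm : 0 ≤ max (10 * ((‖v‖ - η) ^ 2)⁻¹ ^ 6) (28 * ((‖v‖ - η) ^ 2)⁻¹ ^ 9) := le_max_of_le_left (by positivity)
  gcongr

/-- Scalar core of the second-order debit: for `0 ≤ X ≤ R₂·U`, `0 ≤ U ≤ T`, `0 ≤ R₂`: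
`−T·max(0, −(c − 2R₂·max(0,−d))) ≤ c·U + 2d·X`. [folklore] -/
theorem quadForm_floor (c d : ℝ) {X U T R₂ : ℝ} (hX0 : 0 ≤ X) (hX : X ≤ R₂ * U) (hU0 : 0 ≤ U) (hU : U ≤ T) :
    -(T * max 0 (-(c - 2 * R₂ * max 0 (-d)))) ≤ c * U + 2 * d * X := by
  have hm1 : 0 ≤ max 0 (-d) := le_max_left _ _
  have hm1' : -d ≤ max 0 (-d) := le_max_right _ _
  have hm2 : 0 ≤ max 0 (-(c - 2 * R₂ * max 0 (-d))) := le_max_left _ _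
  have hm2' : -(c - 2 * R₂ * max 0 (-d)) ≤ max 0 (-(c - 2 * R₂ * max 0 (-d))) := le_max_right _ _
  have s1 : T * max 0 (-(c - 2 * R₂ * max 0 (-d))) ≥ U * max 0 (-(c - 2 * R₂ * max 0 (-d))) :=
    mul_le_mul_of_nonneg_right hU hm2
  have s2 : -(U * max 0 (-(c - 2 * R₂ * max 0 (-d)))) ≤ (c - 2 * R₂ * max 0 (-d)) * U := by
    have : 0 ≤ (c - 2 * R₂ * max 0 (-d) + max 0 (-(c - 2 * R₂ * max 0 (-d)))) * U :=
      mul_nonneg (by linarith) hU0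
    linarith
  have s3 : max 0 (-d) * X ≤ max 0 (-d) * (R₂ * U) := mul_le_mul_of_nonneg_left hX hm1
  have s4 : 0 ≤ (d + max 0 (-d)) * X := mul_nonneg (by linarith) hX0
  have e : (c - 2 * R₂ * max 0 (-d)) * U = c * U - 2 * (max 0 (-d) * (R₂ * U)) := by ring
  linarith

/-- ★ ENERGY SLOT (from NODE-12): for a bond `x` from the root and a displacement `‖u‖ ≤ τ < ‖x‖`,
`φ(‖x‖²) + ψ(‖x‖²)⟪x,u⟫ − (τ²·secondNeg ‖x‖ + energyRem ‖x‖ τ) ≤ φ(‖x + u‖²)`. [folklore] -/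
theorem phiT_taylor_ge (x u : V) {τ : ℝ} (hu : ‖u‖ ≤ τ) (hx : τ < ‖x‖) :
    phiT (‖x‖ ^ 2) + psiT (‖x‖ ^ 2) * ⟪x, u⟫ - (τ ^ 2 * secondNeg ‖x‖ + energyRem ‖x‖ τ) ≤ phiT (‖x + u‖ ^ 2) := by
  have hτ : 0 ≤ τ := (norm_nonneg u).trans hu
  have hxτ : 0 < ‖x‖ - τ := by linarith
  have hρ : 0 < (‖x‖ - τ) ^ 2 := by positivity
  have h₀ : (‖x‖ - τ) ^ 2 ≤ ‖x‖ ^ 2 := by nlinarith [norm_nonneg x]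
  have h₁ : (‖x‖ - τ) ^ 2 ≤ ‖x + u‖ ^ 2 := sq_le_norm_add_sq_of_le x u hx le_rfl hu
  have h := bond_energy_ge x u hρ h₀ h₁
  -- names for the scalars
  have e0 : 1 / 12 * (‖x‖ ^ 2)⁻¹ ^ 6 - 1 / 6 * (‖x‖ ^ 2)⁻¹ ^ 3 = phiT (‖x‖ ^ 2) := rfl
  have e1 : -(1 / 2) * (‖x‖ ^ 2)⁻¹ ^ 7 + 1 / 2 * (‖x‖ ^ 2)⁻¹ ^ 4 = phiT1 (‖x‖ ^ 2) := rfl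
  have e2 : 7 / 2 * (‖x‖ ^ 2)⁻¹ ^ 8 - 2 * (‖x‖ ^ 2)⁻¹ ^ 5 = phiT2 (‖x‖ ^ 2) := rfl
  have e3 : 1 / 12 * (‖x + u‖ ^ 2)⁻¹ ^ 6 - 1 / 6 * (‖x + u‖ ^ 2)⁻¹ ^ 3 = phiT (‖x + u‖ ^ 2) := rfl
  rw [e0, e1, e2, e3] at h
  -- (a) first order: `2φ′ = ψ`
  have ha : 2 * phiT1 (‖x‖ ^ 2) * ⟪x, u⟫ = psiT (‖x‖ ^ 2) * ⟪x, u⟫ := by rw [psiT_eq_two_mul_phiT1]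
  -- (b) second order ≥ −τ²·secondNeg
  have hb : -(τ ^ 2 * secondNeg ‖x‖) ≤ phiT1 (‖x‖ ^ 2) * ‖u‖ ^ 2 + 2 * phiT2 (‖x‖ ^ 2) * ⟪x, u⟫ ^ 2 := by
    have hX0 : 0 ≤ ⟪x, u⟫ ^ 2 := sq_nonneg _
    have hX : ⟪x, u⟫ ^ 2 ≤ ‖x‖ ^ 2 * ‖u‖ ^ 2 := by
      have h1 := abs_real_inner_le_norm x u
      have h2 : 0 ≤ |⟪x, u⟫| := abs_nonneg _
      calc ⟪x, u⟫ ^ 2 = |⟪x, u⟫| ^ 2 := (sq_abs _).symm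
        _ ≤ (‖x‖ * ‖u‖) ^ 2 := pow_le_pow_left₀ h2 h1 2
        _ = ‖x‖ ^ 2 * ‖u‖ ^ 2 := by ring
    have hu2 : ‖u‖ ^ 2 ≤ τ ^ 2 := pow_le_pow_left₀ (norm_nonneg u) hu 2
    exact quadForm_floor (phiT1 (‖x‖ ^ 2)) (phiT2 (‖x‖ ^ 2)) hX0 hX (sq_nonneg ‖u‖) hu2
  -- (c) third order ≤ energyRem
  have hc : max (14 / 3 * ((‖x‖ - τ) ^ 2)⁻¹ ^ 9) (5 / 3 * ((‖x‖ - τ) ^ 2)⁻¹ ^ 6) * (2 * ‖x‖ * ‖u‖ + ‖u‖ ^ 2) ^ 3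
        + |phiT2 (‖x‖ ^ 2)| * (2 * ‖x‖ * ‖u‖ ^ 3 + 1 / 2 * ‖u‖ ^ 4) ≤ energyRem ‖x‖ τ := by
    unfold energyRem
    have hm : 0 ≤ max (14 / 3 * ((‖x‖ - τ) ^ 2)⁻¹ ^ 9) (5 / 3 * ((‖x‖ - τ) ^ 2)⁻¹ ^ 6) := le_max_of_le_left (by positivity)
    have hq : 2 * ‖x‖ * ‖u‖ + ‖u‖ ^ 2 ≤ 2 * ‖x‖ * τ + τ ^ 2 := by nlinarith [norm_nonneg x, norm_nonneg u]
    have hq0 : 0 ≤ 2 * ‖x‖ * ‖u‖ + ‖u‖ ^ 2 := by positivity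
    gcongr
  linarith

/-! ## §3. The adjoint bookkeeping — NODE-9's certificate in site-indexed form, with slots -/

variable [DecidableEq V]

/-- Displacement allowance of a template atom: the root is pinned (`0`), every other atom may move by `τ`. -/
def dispB (τ : ℝ) (z : V) : ℝ := if z = 0 then 0 else τ

/-- The ADJOINT COEFFICIENT FIELD of the multipliers `y` (NODE-9's `c = Lᵀ y`, written per template site):
`c_z(y) = [z ∈ I]·Σ_{x' ∈ a∖z} L_{z−x'}(y_z) − Σ_{x ∈ I∖z} L_{x−z}(y_x)`, the coefficient of the displacement `δ_z` in the paired linearised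
force balances `Σ_{x∈I} ⟪y_x, Σ_{x'∈a∖x} L_{x−x'}(δ_x − δ_{x'})⟫` (`sum_inner_ljBondForceLin_eq`). -/
def certCoeff (a I : Finset V) (y : V → V) (z : V) : V :=
  (if z ∈ I then ∑ x' ∈ a.erase z, ljBondForceLin (z - x') (y z) else 0) - ∑ x ∈ I.erase z, ljBondForceLin (x - z) (y x)

/-- The multiplier field extended by `0` off the interior `I`. [folklore] -/
def mulExt (I : Finset V) (y : V → V) (x : V) : V := if x ∈ I then y x else 0

/-- ★ BOND-ANTISYMMETRIC BOOKING of a remainder pairing: for an antisymmetric bond quantity `R` (`R x' x = −R x x'` on `a`) bounded by a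
symmetric `fR` on every bond with an end in `I`, `|Σ_{x∈I} ⟪y_x, Σ_{x'∈a∖x} R x x'⟫| ≤ ½·Σ_{x∈a} Σ_{x'∈a∖x} ‖Y_x − Y_{x'}‖·fR x x'` with `Y = mulExt I y`
(each unordered bond is counted twice in the double sum, hence the `½`; bonds with both ends off `I` contribute `0`). [folklore] -/
theorem abs_sum_inner_antisymm_le (a I : Finset V) (y : V → V) (R : V → V → V) (fR : V → V → ℝ) (hIa : I ⊆ a)
    (hR : ∀ x ∈ a, ∀ x' ∈ a, R x' x = -R x x') (hfRs : ∀ x x', fR x x' = fR x' x)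
    (hfR : ∀ x ∈ I, ∀ x' ∈ a.erase x, ‖R x x'‖ ≤ fR x x') :
    |∑ x ∈ I, ⟪y x, ∑ x' ∈ a.erase x, R x x'⟫| ≤ 1 / 2 * ∑ x ∈ a, ∑ x' ∈ a.erase x, ‖mulExt I y x - mulExt I y x'‖ * fR x x' := by
  classical
  -- (1) as a double sum over `a` with the extended multipliers
  have h1 : ∑ x ∈ I, ⟪y x, ∑ x' ∈ a.erase x, R x x'⟫ = ∑ x ∈ a, ∑ x' ∈ a.erase x, ⟪mulExt I y x, R x x'⟫ := by
    rw [← Finset.sum_subset hIa (f := fun x => ∑ x' ∈ a.erase x, ⟪mulExt I y x, R x x'⟫)]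
    · refine Finset.sum_congr rfl fun x hx => ?_
      rw [inner_sum]
      exact Finset.sum_congr rfl fun x' _ => by rw [mulExt, if_pos hx]
    · intro x _ hxI
      exact Finset.sum_eq_zero fun x' _ => by rw [mulExt, if_neg hxI, inner_zero_left]
  -- (2) the swapped double sum
  have h2 : ∑ x ∈ a, ∑ x' ∈ a.erase x, ⟪mulExt I y x, R x x'⟫ = ∑ x ∈ a, ∑ x' ∈ a.erase x, -⟪mulExt I y x', R x x'⟫ := by
    rw [Finset.sum_comm' (t' := a) (s' := fun x' => a.erase x') (h := ?_)]
    · refine Finset.sum_congr rfl fun u hu => Finset.sum_congr rfl fun v hv => ?_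
      rw [hR u hu v (Finset.mem_of_mem_erase hv), inner_neg_right]
    · intro x x'
      simp only [Finset.mem_erase]
      tauto
  -- (3) the symmetrised sum and its termwise Cauchy–Schwarz bound
  have h3 : ∑ x ∈ a, ∑ x' ∈ a.erase x, ⟪mulExt I y x, R x x'⟫ + ∑ x ∈ a, ∑ x' ∈ a.erase x, -⟪mulExt I y x', R x x'⟫ =
      ∑ x ∈ a, ∑ x' ∈ a.erase x, ⟪mulExt I y x - mulExt I y x', R x x'⟫ := by
    rw [← Finset.sum_add_distrib]
    refine Finset.sum_congr rfl fun x _ => ?_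
    rw [← Finset.sum_add_distrib]
    exact Finset.sum_congr rfl fun x' _ => by rw [inner_sub_left, sub_eq_add_neg]
  have h4 : ∀ x ∈ a, ∀ x' ∈ a.erase x,
      |⟪mulExt I y x - mulExt I y x', R x x'⟫| ≤ ‖mulExt I y x - mulExt I y x'‖ * fR x x' := by
    intro x hx x' hx'
    have hx'a := Finset.mem_of_mem_erase hx'
    have hne := Finset.ne_of_mem_erase hx'
    by_cases hxI : x ∈ I
    · exact (abs_real_inner_le_norm _ _).trans (mul_le_mul_of_nonneg_left (hfR x hxI x' hx') (norm_nonneg _))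
    · by_cases hx'I : x' ∈ I
      · have hb : ‖R x x'‖ ≤ fR x x' := by
          rw [hR x' hx'a x hx, norm_neg, hfRs]
          exact hfR x' hx'I x (Finset.mem_erase.2 ⟨hne.symm, hx⟩)
        exact (abs_real_inner_le_norm _ _).trans (mul_le_mul_of_nonneg_left hb (norm_nonneg _))
      · simp [mulExt, hxI, hx'I]
  have h5 : |∑ x ∈ a, ∑ x' ∈ a.erase x, ⟪mulExt I y x - mulExt I y x', R x x'⟫| ≤
      ∑ x ∈ a, ∑ x' ∈ a.erase x, ‖mulExt I y x - mulExt I y x'‖ * fR x x' := by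
    refine (Finset.abs_sum_le_sum_abs _ _).trans (Finset.sum_le_sum fun x hx => ?_)
    exact (Finset.abs_sum_le_sum_abs _ _).trans (Finset.sum_le_sum fun x' hx' => h4 x hx x' hx')
  rw [h1]
  set S := ∑ x ∈ a, ∑ x' ∈ a.erase x, ⟪mulExt I y x, R x x'⟫
  rw [← h2, ← two_mul] at h3
  rw [← h3, abs_mul, abs_two] at h5
  linarith

/-- ★ THE EXCHANGE IDENTITY (summation by parts over the template): for `I ⊆ a`,
`Σ_{x∈I} ⟪y_x, Σ_{x'∈a∖x} L_{x−x'}(δ_x − δ_{x'})⟫ = Σ_{z∈a} ⟪c_z(y), δ_z⟫`. [folklore] -/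
theorem sum_inner_ljBondForceLin_eq (a I : Finset V) (y d : V → V) (hIa : I ⊆ a) :
    ∑ x ∈ I, ⟪y x, ∑ x' ∈ a.erase x, ljBondForceLin (x - x') (d x - d x')⟫ = ∑ z ∈ a, ⟪certCoeff a I y z, d z⟫ := by
  classical
  have hexp : ∀ x x' : V, ⟪y x, ljBondForceLin (x - x') (d x - d x')⟫ =
      ⟪ljBondForceLin (x - x') (y x), d x⟫ - ⟪ljBondForceLin (x - x') (y x), d x'⟫ := fun x x' => by
    rw [ljBondForceLin_sub, inner_sub_right, inner_ljBondForceLin_comm, inner_ljBondForceLin_comm]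
  simp_rw [inner_sum, hexp, Finset.sum_sub_distrib]
  -- part A: the `δ_x` terms
  have hA : ∑ x ∈ I, ∑ x' ∈ a.erase x, ⟪ljBondForceLin (x - x') (y x), d x⟫ =
      ∑ z ∈ a, ⟪(if z ∈ I then ∑ x' ∈ a.erase z, ljBondForceLin (z - x') (y z) else 0), d z⟫ := by
    calc ∑ x ∈ I, ∑ x' ∈ a.erase x, ⟪ljBondForceLin (x - x') (y x), d x⟫
        = ∑ z ∈ I, ⟪(if z ∈ I then ∑ x' ∈ a.erase z, ljBondForceLin (z - x') (y z) else 0), d z⟫ :=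
          Finset.sum_congr rfl fun x hx => by rw [if_pos hx, sum_inner]
      _ = ∑ z ∈ a, ⟪(if z ∈ I then ∑ x' ∈ a.erase z, ljBondForceLin (z - x') (y z) else 0), d z⟫ :=
          Finset.sum_subset hIa fun z _ hz => by rw [if_neg hz, inner_zero_left]
  -- part B: the `δ_{x'}` terms, order of summation exchanged
  have hB : ∑ x ∈ I, ∑ x' ∈ a.erase x, ⟪ljBondForceLin (x - x') (y x), d x'⟫ =
      ∑ z ∈ a, ⟪∑ x ∈ I.erase z, ljBondForceLin (x - z) (y x), d z⟫ := by
    rw [Finset.sum_comm' (t' := a) (s' := fun z => I.erase z)]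
    · exact Finset.sum_congr rfl fun z _ => by rw [sum_inner]
    · intro x z
      simp only [Finset.mem_erase]
      constructor
      · rintro ⟨hx, hzx, hz⟩; exact ⟨⟨fun h => hzx h.symm, hx⟩, hz⟩
      · rintro ⟨⟨hxz, hx⟩, hz⟩; exact ⟨hx, fun h => hxz h.symm, hz⟩
  rw [hA, hB, ← Finset.sum_sub_distrib]
  exact Finset.sum_congr rfl fun z _ => by rw [certCoeff, inner_sub_left]

/-- ★★ THE COHERENT-WINDOW FLOOR WITH SLOTS (pure template algebra; NODE-9's adjoint certificate, `V`-indexed).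
Template `a` (root `0`, interior `I ⊆ a`), ARBITRARY multipliers `y : V → V` ("centre dual"), a displacement field `d` with `d 0 = 0`,
`‖d z‖ ≤ τ` on `a`, and three SLOTS: an energy slot `eR` (second+third order debit per bond), a force-remainder slot `fR`, a far-residual
slot `C` bounding the actual in-window force on each interior atom.  Then
`Σ_{x∈a∖0}(φ(|x|²) − eR x) − τ·Σ_{z∈a∖0} ‖ψ(|z|²)z − c_z(y)‖ − Σ_{x∈I}⟪y_x, H_x⟫ − Σ_{x∈I} ‖y_x‖·C x − ½·Σ_{x∈a}Σ_{x'∈a∖x} ‖Y_x − Y_{x'}‖·fR x x'`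
`≤ Σ_{x∈a∖0} φ(|x + d x|²)`, `H_x = Σ_{x'∈a∖x} F(x − x')` the exact (signed) host force of the template, `Y = mulExt I y` (the remainder
pairing is booked per BOND with `‖y_x − y_{x'}‖`, `abs_sum_inner_antisymm_le` + `forceTaylorRem_swap`; `fR` symmetric).
[folklore; NODE-9 `…AdjointCertificate` is the flattened `ℓ¹` special case] -/
theorem windowSum_ge (a I : Finset V) (y d : V → V) (τ : ℝ) (eR : V → ℝ) (fR : V → V → ℝ) (C : V → ℝ)
    (hIa : I ⊆ a) (hd0 : d 0 = 0) (hd : ∀ z ∈ a, ‖d z‖ ≤ τ)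
    (heR : ∀ x ∈ a.erase 0, phiT (‖x‖ ^ 2) + psiT (‖x‖ ^ 2) * ⟪x, d x⟫ - eR x ≤ phiT (‖x + d x‖ ^ 2))
    (hfR : ∀ x ∈ I, ∀ x' ∈ a.erase x,
      ‖ljBondForce ((x + d x) - (x' + d x')) - ljBondForce (x - x') - ljBondForceLin (x - x') (d x - d x')‖ ≤ fR x x')
    (hfRs : ∀ x x', fR x x' = fR x' x) (hC : ∀ x ∈ I, ‖∑ x' ∈ a.erase x, ljBondForce ((x + d x) - (x' + d x'))‖ ≤ C x) :
    ∑ x ∈ a.erase 0, (phiT (‖x‖ ^ 2) - eR x) - τ * ∑ z ∈ a.erase 0, ‖psiT (‖z‖ ^ 2) • z - certCoeff a I y z‖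
        - ∑ x ∈ I, ⟪y x, ∑ x' ∈ a.erase x, ljBondForce (x - x')⟫ - ∑ x ∈ I, ‖y x‖ * C x
        - 1 / 2 * ∑ x ∈ a, ∑ x' ∈ a.erase x, ‖mulExt I y x - mulExt I y x'‖ * fR x x'
      ≤ ∑ x ∈ a.erase 0, phiT (‖x + d x‖ ^ 2) := by
  classical
  -- (1) the energy slots, summed over the bonds of the root
  have h1 : ∑ x ∈ a.erase 0, (phiT (‖x‖ ^ 2) - eR x) + ∑ x ∈ a.erase 0, ⟪psiT (‖x‖ ^ 2) • x, d x⟫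
      ≤ ∑ x ∈ a.erase 0, phiT (‖x + d x‖ ^ 2) := by
    rw [← Finset.sum_add_distrib]
    refine Finset.sum_le_sum fun x hx => ?_
    rw [real_inner_smul_left]
    linarith [heR x hx]
  -- (2) first-order functional = residual part + certificate part (the root term vanishes as `d 0 = 0`)
  have h2 : ∑ z ∈ a.erase 0, ⟪psiT (‖z‖ ^ 2) • z, d z⟫ =
      ∑ z ∈ a.erase 0, ⟪psiT (‖z‖ ^ 2) • z - certCoeff a I y z, d z⟫ + ∑ z ∈ a, ⟪certCoeff a I y z, d z⟫ := by
    have hz : ∑ z ∈ a.erase 0, ⟪certCoeff a I y z, d z⟫ = ∑ z ∈ a, ⟪certCoeff a I y z, d z⟫ :=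
      Finset.sum_erase a (by rw [hd0, inner_zero_right])
    rw [← hz, ← Finset.sum_add_distrib]
    exact Finset.sum_congr rfl fun z _ => by rw [inner_sub_left]; ring
  -- (3) Cauchy–Schwarz on the residual part
  have h3 : -(τ * ∑ z ∈ a.erase 0, ‖psiT (‖z‖ ^ 2) • z - certCoeff a I y z‖) ≤
      ∑ z ∈ a.erase 0, ⟪psiT (‖z‖ ^ 2) • z - certCoeff a I y z, d z⟫ := by
    rw [Finset.mul_sum, ← Finset.sum_neg_distrib]
    refine Finset.sum_le_sum fun z hz => ?_
    have hcs := (abs_le.mp (abs_real_inner_le_norm (psiT (‖z‖ ^ 2) • z - certCoeff a I y z) (d z))).1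
    have hdz := hd z (Finset.mem_of_mem_erase hz)
    nlinarith [norm_nonneg (psiT (‖z‖ ^ 2) • z - certCoeff a I y z)]
  -- (4) the exchange identity
  have h4 : ∑ z ∈ a, ⟪certCoeff a I y z, d z⟫ = ∑ x ∈ I, ⟪y x, ∑ x' ∈ a.erase x, ljBondForceLin (x - x') (d x - d x')⟫ :=
    (sum_inner_ljBondForceLin_eq a I y d hIa).symm
  -- (5) per interior atom: linearised force = actual − host − remainder, paired with `y_x`
  set R : V → V → V := fun x x' => ljBondForce ((x + d x) - (x' + d x')) - ljBondForce (x - x') - ljBondForceLin (x - x') (d x - d x')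
    with hRdef
  have h5 : ∀ x ∈ I, -(‖y x‖ * C x) - ⟪y x, ∑ x' ∈ a.erase x, ljBondForce (x - x')⟫ - ⟪y x, ∑ x' ∈ a.erase x, R x x'⟫ ≤
      ⟪y x, ∑ x' ∈ a.erase x, ljBondForceLin (x - x') (d x - d x')⟫ := by
    intro x hx
    have hL : ∑ x' ∈ a.erase x, ljBondForceLin (x - x') (d x - d x') =
        ∑ x' ∈ a.erase x, ljBondForce ((x + d x) - (x' + d x')) - ∑ x' ∈ a.erase x, ljBondForce (x - x')
          - ∑ x' ∈ a.erase x, R x x' := by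
      rw [← Finset.sum_sub_distrib, ← Finset.sum_sub_distrib]
      exact Finset.sum_congr rfl fun x' _ => by simp only [hRdef]; abel
    rw [hL, inner_sub_right, inner_sub_right]
    have hcs := (abs_le.mp (abs_real_inner_le_norm (y x) (∑ x' ∈ a.erase x, ljBondForce ((x + d x) - (x' + d x'))))).1
    nlinarith [hC x hx, norm_nonneg (y x)]
  have h6 : -(∑ x ∈ I, ‖y x‖ * C x) - ∑ x ∈ I, ⟪y x, ∑ x' ∈ a.erase x, ljBondForce (x - x')⟫ - ∑ x ∈ I, ⟪y x, ∑ x' ∈ a.erase x, R x x'⟫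
      ≤ ∑ x ∈ I, ⟪y x, ∑ x' ∈ a.erase x, ljBondForceLin (x - x') (d x - d x')⟫ := by
    rw [← Finset.sum_neg_distrib, ← Finset.sum_sub_distrib, ← Finset.sum_sub_distrib]
    exact Finset.sum_le_sum h5
  -- (6) the remainder pairing, booked per bond
  have h7 : |∑ x ∈ I, ⟪y x, ∑ x' ∈ a.erase x, R x x'⟫| ≤ 1 / 2 * ∑ x ∈ a, ∑ x' ∈ a.erase x, ‖mulExt I y x - mulExt I y x'‖ * fR x x' :=
    abs_sum_inner_antisymm_le a I y R fR hIa (fun x _ x' _ => by rw [hRdef]; exact forceTaylorRem_swap x x' (d x) (d x')) hfRs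
      fun x hx x' hx' => by rw [hRdef]; exact hfR x hx x' hx'
  have h8 := (abs_le.mp h7).2
  linarith [h1, h2, h3, h4, h6, h8]

end Summit.AtomisticToContinuum.Crystallization.Theorems.FrustratedLawDichotomyCoherentFloorAlgebra

end
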